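import Summits.QuantumFields.QCD.Theses.HeatSlicedQuarks
import Literature.MathematicalPhysics.QuantumLattice.WilsonDiracAP
import Literature.MathematicalPhysics.QuantumLattice.WilsonFermionGramRegularity
import Literature.MathematicalPhysics.QuantumFieldTheory.LatticeGaugeStaticPotentialProofs
import Literature.MathematicalPhysics.QuantumFieldTheory.ConstructiveQFTWave0Proofs
import Literature.MathematicalPhysics.QuantumFieldTheory.QCDPhaseQuenched
import Summits.QuantumFields.QCD.Theorems.QuarksAsStableActionUnquenchedChessboardBoundStubAxisSwap

/-!
# Fine-weight admissibility, part 1: measurability and the lattice symmetries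
(crux stmt-QuantumFields-18031 `HeatSlicedQuarks.InterleavedFlowProper`, line `Sketch`,
stub `stub_fineWeightAdmissible`, clauses (1), (3), (4), (5))

The fine weight of the line is the quark-integrated Wilson weight of lattice QCD with `N_f` flavours
of `r = 1` Wilson quarks ANTIPERIODIC IN ALL FOUR DIRECTIONS on the four-torus `(ℤ/L)⁴`,
`w(U) = exp(-β S_W(U)) · Re ∏_f det D_AP[U, m_f]`, where `D_AP[U, m] = wilsonDiracAP U m` is the
tree's antiperiodic Wilson–Dirac operator (`Literature…QuantumLattice.WilsonDiracAP`; the skeleton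
inlines its antiperiodic lift `apLift` as a literal `if`, definitionally equal). This file proves:

* clause (1): `w` is measurable (`measurable_fineWeight`; `U ↦ det D_AP[U, m]` is continuous,
  `continuous_fermionDet_wilsonDiracAP`, and the configuration space `SU(N)^{edges}` is a compact
  metrisable space with its Borel structure);
* clause (3): `w` is invariant under lattice translations (`fineWeight_torusConfigShift`, from the
  tree's `wilsonAction_torusConfigShift` and `fermionDet_wilsonDiracAP_torusConfigShift`);
* clause (4): `w` is invariant under the link time reflection `GaugeConfig.timeReflect`
  (`fineWeight_timeReflect`, from `WilsonRP.plaqRe_timeReflect` and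
  `fermionDet_wilsonDiracAP_timeReflect`);
* clause (5): `w` is invariant under the permutations `(πU)(x, j) = U(x ∘ π, π⁻¹ j)` of the four
  axes (`fineWeight_axisPerm`): the Wilson action by the tree's `wilsonAction_configPerm`, the
  antiperiodic determinant by the transpositions `(0 i)` of the landed stub `stub_axisSwap`
  (`det_wilsonDiracAP_swap`: the four antiperiodic seams are permuted among themselves and the
  spin projectors are conjugate) which generate the symmetric group, the action being
  multiplicative (`axisAct_mul`).

References: K. Osterwalder, E. Seiler, Ann. Phys. 110 (1978) 440, §2; I. Montvay, G. Münster,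
*Quantum Fields on a Lattice* (CUP 1994), §4.2.3–4.2.4, §5.1.2.
-/

noncomputable section

namespace Summit.QuantumFields.QCD.Cruxes.InterleavedFlowProper.OffsetLastFormatHandover

open Literature.MathematicalPhysics.QuantumFieldTheory Literature.MathematicalPhysics.QuantumLattice
  Literature.MathematicalPhysics.AQFT
open Filter Topology MeasureTheory Matrix Complex Finset

namespace FineWeight

variable {L N : ℕ}

/-! ## The axis action -/

/-- The action `(πU)(x, j) = U(x ∘ π, π⁻¹ j)` of the permutations of the four axes on lattice
gauge fields (the form used by `HeavyThresholdYMBridge.RobustYangMillsRG`; it is the tree's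
`configPerm π`). -/
theorem configPerm_eq_comp {G : Type*} [MeasurableSpace G] (π : Equiv.Perm (Fin 4))
    (U : GaugeConfig 4 L G) :
    (configPerm π U : GaugeConfig 4 L G) = U ∘ fun e => (e.1 ∘ ⇑π, π.symm e.2) := by
  funext e
  rw [configPerm_apply]
  rfl

/-- The axis action is multiplicative: `(στ)U = σ(τU)`. -/
theorem axisAct_mul {G : Type*} (σ τ : Equiv.Perm (Fin 4)) (U : GaugeConfig 4 L G) :
    (U ∘ fun e : Edge 4 L => (e.1 ∘ ⇑(σ * τ), (σ * τ).symm e.2)) =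
      (U ∘ fun e : Edge 4 L => (e.1 ∘ ⇑τ, τ.symm e.2)) ∘ fun e : Edge 4 L => (e.1 ∘ ⇑σ, σ.symm e.2) := by
  funext e
  rfl

/-- The identity acts trivially. -/
theorem axisAct_one {G : Type*} (U : GaugeConfig 4 L G) :
    (U ∘ fun e : Edge 4 L => (e.1 ∘ ⇑(1 : Equiv.Perm (Fin 4)), (1 : Equiv.Perm (Fin 4)).symm e.2)) = U := by
  funext e
  rfl

/-- `Equiv.refl` acts trivially. -/
theorem axisAct_refl {G : Type*} (U : GaugeConfig 4 L G) :
    (U ∘ fun e : Edge 4 L => (e.1 ∘ ⇑(Equiv.refl (Fin 4)), (Equiv.refl (Fin 4)).symm e.2)) = U := by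
  funext e
  rfl

/-- A transposition `(0 i)` in the form of the axis action. -/
theorem axisAct_swap_zero {G : Type*} (i : Fin 4) (U : GaugeConfig 4 L G) :
    (U ∘ fun e : Edge 4 L => (e.1 ∘ ⇑(Equiv.swap (0 : Fin 4) i), (Equiv.swap (0 : Fin 4) i).symm e.2)) =
      fun e : Edge 4 L => U (e.1 ∘ ⇑(Equiv.swap (0 : Fin 4) i), Equiv.swap (0 : Fin 4) i e.2) := by
  funext e
  simp only [Function.comp_apply, Equiv.symm_swap]

variable [NeZero L]

/-! ## Continuity and measurability of the antiperiodic determinant -/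

omit [NeZero L] in
/-- The antiperiodic `U(N)` lift depends continuously on the `SU(N)` gauge field. -/
theorem continuous_apLift : Continuous (apLift : GaugeConfig 4 L (Matrix.specialUnitaryGroup (Fin N) ℂ) →
      GaugeConfig 4 L (Matrix.unitaryGroup (Fin N) ℂ)) := by
  refine continuous_pi fun e => continuous_induced_rng.2 ?_
  have h : (Subtype.val ∘ fun U : GaugeConfig 4 L (Matrix.specialUnitaryGroup (Fin N) ℂ) => apLift U e) =
      fun U : GaugeConfig 4 L (Matrix.specialUnitaryGroup (Fin N) ℂ) => if e.1 e.2 = -1 then -(U e : Matrix (Fin N) (Fin N) ℂ)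
        else (U e : Matrix (Fin N) (Fin N) ℂ) := by
    funext U
    exact coe_apLift_apply U e
  rw [h]
  split_ifs
  · exact (continuous_subtype_val.comp (continuous_apply e)).neg
  · exact continuous_subtype_val.comp (continuous_apply e)

omit [NeZero L] in
/-- `U ↦ D_AP[U, m]` is continuous. -/
theorem continuous_wilsonDiracAP (m : ℝ) :
    Continuous fun U : GaugeConfig 4 L (Matrix.specialUnitaryGroup (Fin N) ℂ) => wilsonDiracAP (N := N) U m := by
  simp only [wilsonDiracAP_def]
  exact (continuous_wilsonDirac (unitaryFundamentalRep (Fin N) ℂ)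
    (continuous_unitaryFundamentalRep (n := Fin N) (𝕜 := ℂ)) m 1).comp continuous_apLift

/-- `U ↦ det D_AP[U, m]` is continuous. -/
theorem continuous_fermionDet_wilsonDiracAP (m : ℝ) :
    Continuous fun U : GaugeConfig 4 L (Matrix.specialUnitaryGroup (Fin N) ℂ) => fermionDet (wilsonDiracAP (N := N) U m) :=
  (continuous_wilsonDiracAP m).matrix_det

/-- The configuration space `SU(N)^{edges}` carries the Borel structure of its compact metrisable
product topology (so continuous functions of the gauge field are measurable). -/
theorem opensMeasurableSpace_gaugeConfig' :
    OpensMeasurableSpace (GaugeConfig 4 L (Matrix.specialUnitaryGroup (Fin N) ℂ)) := by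
  haveI : SecondCountableTopology (Matrix.specialUnitaryGroup (Fin N) ℂ) :=
    secondCountableTopology_specialUnitaryGroup
  exact Pi.opensMeasurableSpace

/-- `U ↦ det D_AP[U, m]` is measurable. -/
theorem measurable_fermionDet_wilsonDiracAP (m : ℝ) :
    Measurable fun U : GaugeConfig 4 L (Matrix.specialUnitaryGroup (Fin N) ℂ) =>
      fermionDet (wilsonDiracAP (N := N) U m) := by
  haveI := opensMeasurableSpace_gaugeConfig' (L := L) (N := N)
  exact (continuous_fermionDet_wilsonDiracAP m).measurable

/-- The flavour product `U ↦ Re ∏_f det D_AP[U, m_f]` is continuous. -/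
theorem continuous_re_prod_fermionDet_wilsonDiracAP {Nf : ℕ} (mq : Fin Nf → ℝ) :
    Continuous fun U : GaugeConfig 4 L (Matrix.specialUnitaryGroup (Fin N) ℂ) => (∏ f, fermionDet (wilsonDiracAP (N := N) U (mq f))).re :=
  Complex.continuous_re.comp (continuous_finsetProd _ fun f _ => continuous_fermionDet_wilsonDiracAP (mq f))

/-! ## The Wilson action under the link time reflection -/

/-- The Wilson action is invariant under the link time reflection `Θ` (any torus size). -/
theorem wilsonAction_timeReflect' {d : ℕ} [NeZero d] {G : Type*} [Group G]
    [TopologicalSpace G] [IsTopologicalGroup G] [CompactSpace G] (ρ : G →* Matrix (Fin N) (Fin N) ℂ)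
    (hρ : Continuous ρ) (U : GaugeConfig d L G) :
    wilsonAction ρ U.timeReflect = wilsonAction ρ U := by
  -- adapted from `Summit.QuantumFields.QCD.Theorems.RobustYangMills.Negative.wilsonAction_timeReflect`
  unfold wilsonAction
  have h : ∀ p : Plaquette d L,
      (ρ (plaquetteHolonomy U.timeReflect p.1 p.2.1.1 p.2.1.2)).trace.re =
        (ρ (plaquetteHolonomy U (WilsonRP.plaqReflect p).1 (WilsonRP.plaqReflect p).2.1.1
          (WilsonRP.plaqReflect p).2.1.2)).trace.re :=
    fun p => WilsonRP.plaqRe_timeReflect ρ hρ U p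
  simp_rw [h]
  exact Fintype.sum_equiv WilsonRP.plaqReflectEquiv _ _ (fun p => rfl)

/-! ## Axis permutations -/

/-- **`det D_AP` is invariant under every permutation of the four axes** (`SU(3)` quarks): the
transpositions `(0 i)` of `stub_axisSwap` generate the symmetric group and the action is
multiplicative. -/
theorem det_wilsonDiracAP_axisPerm (π : Equiv.Perm (Fin 4))
    (U : GaugeConfig 4 L (Matrix.specialUnitaryGroup (Fin 3) ℂ)) (m : ℝ) :
    (wilsonDiracAP (U ∘ fun e : Edge 4 L => (e.1 ∘ ⇑π, π.symm e.2)) m).det = (wilsonDiracAP U m).det := by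
  -- invariance under one transposition through `0`
  have h0 : ∀ (i : Fin 4) (V : GaugeConfig 4 L (Matrix.specialUnitaryGroup (Fin 3) ℂ)),
      (wilsonDiracAP (V ∘ fun e : Edge 4 L =>
        (e.1 ∘ ⇑(Equiv.swap (0 : Fin 4) i), (Equiv.swap (0 : Fin 4) i).symm e.2)) m).det =
        (wilsonDiracAP V m).det := fun i V => by
    rw [axisAct_swap_zero]
    exact Summit.QuantumFields.QCD.Theorems.UnquenchedChessboardBoundLine.AxisSwap.det_wilsonDiracAP_swap V i m
  -- invariance under an arbitrary transposition
  have hs : ∀ (x y : Fin 4) (V : GaugeConfig 4 L (Matrix.specialUnitaryGroup (Fin 3) ℂ)),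
      (wilsonDiracAP (V ∘ fun e : Edge 4 L =>
        (e.1 ∘ ⇑(Equiv.swap x y), (Equiv.swap x y).symm e.2)) m).det = (wilsonDiracAP V m).det := by
    intro x y V
    by_cases hx : x = 0
    · subst hx; exact h0 y V
    by_cases hy : y = 0
    · subst hy; rw [Equiv.swap_comm]; exact h0 x V
    by_cases hxy : x = y
    · subst hxy
      rw [Equiv.swap_self, axisAct_refl]
    · -- `swap x y = swap 0 x * swap y 0 * swap 0 x`
      have hdec : Equiv.swap x y = Equiv.swap (0 : Fin 4) x * Equiv.swap y (0 : Fin 4) * Equiv.swap (0 : Fin 4) x :=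
        (Equiv.swap_mul_swap_mul_swap (x := y) (y := (0 : Fin 4)) (z := x) hy (Ne.symm hxy)).symm
      rw [hdec, axisAct_mul, axisAct_mul, h0 x, Equiv.swap_comm y 0, h0 y, h0 x]
  -- induction over a product of transpositions
  induction π using Equiv.Perm.swap_induction_on generalizing U with
  | one => rw [axisAct_one]
  | swap_mul f x y hxy ih => rw [axisAct_mul, hs x y, ih]

/-- **The Wilson action is invariant under every permutation of the four axes** (the tree's
`wilsonAction_configPerm` in the form of the axis action). -/
theorem wilsonAction_axisPerm {G : Type*} [Group G] [TopologicalSpace G] [IsTopologicalGroup G]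
    [CompactSpace G] [MeasurableSpace G] (ρ : G →* Matrix (Fin N) (Fin N) ℂ) (hρ : Continuous ρ)
    (π : Equiv.Perm (Fin 4)) (U : GaugeConfig 4 L G) :
    wilsonAction ρ (U ∘ fun e : Edge 4 L => (e.1 ∘ ⇑π, π.symm e.2)) = wilsonAction ρ U := by
  rw [← configPerm_eq_comp]
  exact wilsonAction_configPerm ρ hρ π U

end FineWeight

/-! ## The fine-weight clauses (1), (3), (4), (5) -/

section Clauses

open FineWeight

variable {L : ℕ} [NeZero L] {Nf : ℕ}

/-- **Clause (1): the fine weight is measurable** (indeed continuous) in the gauge field. -/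
theorem measurable_fineWeight (β : ℝ) (mq : Fin Nf → ℝ) :
    Measurable fun U : GaugeConfig 4 L (Matrix.specialUnitaryGroup (Fin 3) ℂ) =>
      Real.exp (-(β * wilsonAction (fundamentalRep (Fin 3)) U)) *
        (∏ f, fermionDet (wilsonDiracAP U (mq f))).re := by
  haveI := opensMeasurableSpace_gaugeConfig' (L := L) (N := 3)
  exact ((Real.measurable_exp.comp (((WilsonRP.measurable_wilsonAction (fundamentalRep (Fin 3))
    (continuous_fundamentalRep (Fin 3))).const_mul β).neg)).mul
    (continuous_re_prod_fermionDet_wilsonDiracAP mq).measurable)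

/-- **Clause (3): the fine weight is invariant under lattice translations.** -/
theorem fineWeight_torusConfigShift (β : ℝ) (mq : Fin Nf → ℝ) (v : Site 4 L) (U : GaugeConfig 4 L (Matrix.specialUnitaryGroup (Fin 3) ℂ)) :
    Real.exp (-(β * wilsonAction (fundamentalRep (Fin 3)) (torusConfigShift v U))) *
        (∏ f, fermionDet (wilsonDiracAP (torusConfigShift v U) (mq f))).re =
      Real.exp (-(β * wilsonAction (fundamentalRep (Fin 3)) U)) *
        (∏ f, fermionDet (wilsonDiracAP U (mq f))).re := by
  simp only [wilsonAction_torusConfigShift, fermionDet_wilsonDiracAP_torusConfigShift]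

/-- **Clause (4): the fine weight is invariant under the link time reflection `Θ`.** -/
theorem fineWeight_timeReflect (β : ℝ) (mq : Fin Nf → ℝ) (U : GaugeConfig 4 L (Matrix.specialUnitaryGroup (Fin 3) ℂ)) :
    Real.exp (-(β * wilsonAction (fundamentalRep (Fin 3)) U.timeReflect)) *
        (∏ f, fermionDet (wilsonDiracAP U.timeReflect (mq f))).re =
      Real.exp (-(β * wilsonAction (fundamentalRep (Fin 3)) U)) *
        (∏ f, fermionDet (wilsonDiracAP U (mq f))).re := by
  simp only [wilsonAction_timeReflect' (fundamentalRep (Fin 3)) (continuous_fundamentalRep (Fin 3)),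
    fermionDet_wilsonDiracAP_timeReflect]

/-- **Clause (5): the fine weight is invariant under the permutations of the four axes.** -/
theorem fineWeight_axisPerm (β : ℝ) (mq : Fin Nf → ℝ) (π : Equiv.Perm (Fin 4)) (U : GaugeConfig 4 L (Matrix.specialUnitaryGroup (Fin 3) ℂ)) :
    Real.exp (-(β * wilsonAction (fundamentalRep (Fin 3)) (U ∘ fun e => (e.1 ∘ ⇑π, π.symm e.2)))) *
        (∏ f, fermionDet (wilsonDiracAP (U ∘ fun e => (e.1 ∘ ⇑π, π.symm e.2)) (mq f))).re =
      Real.exp (-(β * wilsonAction (fundamentalRep (Fin 3)) U)) *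
        (∏ f, fermionDet (wilsonDiracAP U (mq f))).re := by
  have hdet : ∀ f, fermionDet (wilsonDiracAP (U ∘ fun e => (e.1 ∘ ⇑π, π.symm e.2)) (mq f)) =
      fermionDet (wilsonDiracAP U (mq f)) := fun f => det_wilsonDiracAP_axisPerm π U (mq f)
  simp only [wilsonAction_axisPerm (fundamentalRep (Fin 3)) (continuous_fundamentalRep (Fin 3)), hdet]

/-- **Registered sub-goal `stubFW_symm` of `stub_fineWeightAdmissible`**: clauses (1), (3), (4), (5) of
the admissibility predicate for the all-axes-antiperiodic quark-integrated Wilson weight, on every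
torus `(ℤ/L)⁴` and for all `β`, `m_f` (no sign or parity hypothesis is needed for these four). -/
theorem stubFW_symm : ∀ (L : ℕ) [NeZero L] (Nf : ℕ) (β : ℝ) (mq : Fin Nf → ℝ),
    (Measurable fun U : GaugeConfig 4 L (Matrix.specialUnitaryGroup (Fin 3) ℂ) =>
      Real.exp (-(β * wilsonAction (fundamentalRep (Fin 3)) U)) * (∏ f, fermionDet (wilsonDiracAP U (mq f))).re) ∧
    (∀ (v : Site 4 L) (U : GaugeConfig 4 L (Matrix.specialUnitaryGroup (Fin 3) ℂ)),
      Real.exp (-(β * wilsonAction (fundamentalRep (Fin 3)) (torusConfigShift v U))) *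
          (∏ f, fermionDet (wilsonDiracAP (torusConfigShift v U) (mq f))).re =
        Real.exp (-(β * wilsonAction (fundamentalRep (Fin 3)) U)) * (∏ f, fermionDet (wilsonDiracAP U (mq f))).re) ∧
    (∀ U : GaugeConfig 4 L (Matrix.specialUnitaryGroup (Fin 3) ℂ),
      Real.exp (-(β * wilsonAction (fundamentalRep (Fin 3)) U.timeReflect)) *
          (∏ f, fermionDet (wilsonDiracAP U.timeReflect (mq f))).re =
        Real.exp (-(β * wilsonAction (fundamentalRep (Fin 3)) U)) * (∏ f, fermionDet (wilsonDiracAP U (mq f))).re) ∧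
    (∀ (π : Equiv.Perm (Fin 4)) (U : GaugeConfig 4 L (Matrix.specialUnitaryGroup (Fin 3) ℂ)),
      Real.exp (-(β * wilsonAction (fundamentalRep (Fin 3)) (U ∘ fun e => (e.1 ∘ ⇑π, π.symm e.2)))) *
          (∏ f, fermionDet (wilsonDiracAP (U ∘ fun e => (e.1 ∘ ⇑π, π.symm e.2)) (mq f))).re =
        Real.exp (-(β * wilsonAction (fundamentalRep (Fin 3)) U)) * (∏ f, fermionDet (wilsonDiracAP U (mq f))).re) :=
  fun _ _ _ β mq => ⟨measurable_fineWeight β mq, fun v U => fineWeight_torusConfigShift β mq v U,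
    fun U => fineWeight_timeReflect β mq U, fun π U => fineWeight_axisPerm β mq π U⟩

end Clauses

end Summit.QuantumFields.QCD.Cruxes.InterleavedFlowProper.OffsetLastFormatHandover

end
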